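import Summits.BirchSwinnertonDyer.BirchSwinnertonDyer.Theorems.ByReductionTypeAtTwoSupersingularThetaClass157113h
import Summits.BirchSwinnertonDyer.BirchSwinnertonDyer.Theorems.ByReductionTypeAtTwoSupersingularThetaHabitatUnitZone
import HarnessLib

/-!
# Crux `SupersingularRankZeroAtTwo` (item stmt-BirchSwinnertonDyer-19097, route ByReductionTypeAtTwo, rung K4):
# CLASS INSTANCE on the UNIT-ZONE theta road — the X5@2 good-supersingular `a₂ = 0` class **157113h**
# (member `157113h1 = [0, 0, 1, -2285565660, -42057036462382]`, `N = 157113`) with its UNIT-ZONE CM partner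
# `cmA27a` = Cremona 27a3 = y² + y = x³ (`[0, 0, 1, 0, 0]`, `N = 27`, `L(A,1)/Ω_A = 1/9`)
# — seat `bsd-2adic-ss-1x` GEN 2 (WIDTH-LEVER second lane); TP2's K2r0 is NOT a binder here

HONEST FRAMING (cell `bsd-2adic`, run/shared/lean/pub/bsd-2adic/): a CLASS INSTANCE, not a booking; THEOREMS ONLY; no
definition, no named fact, no instance; BSD is NOT proved by any of this. PARTITION (D-0054): X5@2 good-supersingular,
`a₂ = 0`, UNIT-ZONE THETA HABITAT (1 of the 19 theta-habitat classes of record: 157113h; kit census j280801) × `p = 2` —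
types-the-object-of (item 19097 AT the class `157113h`); closes none. Compared with GEN 0's displays on this class
(`SSThetaRoad.bsdp_two_157113h1_of_signedTransport_of_stubs`, p533019: stubs (1)(1′)(2′)(4) + TP2 K1 + K2r0 + CERT),
the display below DROPS TP2's crux K2r0 `SignedMainConjectureCMTwoRankZero` (Pollack–Rubin at the inert prime `2`, OPEN) and
carries instead: Kim's signed `Γ`-Euler characteristic at `2` read for CM curves ((2′)^CM = stub (2′) with `¬ HasCM` ↦
`HasCM`, displayed ∀-clause), Burungale–Flach (PUB named fact `bsdTriple_of_hasCM_of_L_one_ne_zero`), Abbes–Ullmo at `2`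
(PUB named fact `realPeriodRat_eq_unit_mul_plusPeriod_two`) and the UNIT CERTIFICATE `L(A,1)/Ω_A = t`, `t ≠ 0`,
`ord₂ t = 0` for `A = 27a3` (RECORD: Cremona allbsd `27 a 3 [0,0,1,0,0]`: `#tors = 3`, `Tam = 1`, `Ω = 5.29991625…`,
`L = 0.58887958…`, `Ш_an = 1`, so `t = 1/9`; second engine PARI `ellL1`/`ellbsd` in kit j280801: `Ш_an = 1.000…`,
`ord₂(L/Ω) = 0`). KERNEL-DECIDED (imported): `E` non-CM, globally minimal, good supersingular at `2` with `a₂ = 0`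
(lane A's `…SupersingularColemanClass157113h`); `A` CM, globally minimal, good supersingular at `2` with `a₂ = 0`
(`…ThetaPartnersA`); `E[2] ≅ A[2]` as Galois modules (Tschirnhaus certificate, GEN 0's `twoTorsion_congruent_157113h1`).
Door: `ThetaPartnerXRoute.bsdp_two_of_unitZonePartner_of_signedTransport_of_stubs` (this seat, GEN 2).
References: [CremonaAlgorithms1997] Table 1 (157113h1, 27a3); [Kobayashi2003] Thm. 1.2, 4.1; [BDKim2013] Cor. 3.15;
[GreenbergVatsal2000] Thm. (1.4); [BurungaleFlach2024] Thm. 1.1; [AbbesUllmo1996] Thm. A; [KuriharaOtsuki2006] Rem. 0.2 (3)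
(`X₀(27)`: the `L♭`-side function is a unit of `Λ`); [Kato2004Asterisque] Thm. 12.4–12.5; [Miller2011LMS] Def. 1.1.
-/

set_option autoImplicit false
-- the Theorems namespace of this sub repeats the summit name by design (D-0017 nested layout)
set_option linter.dupNamespace false

noncomputable section

open scoped Classical Polynomial

open CongruenceSubgroup WeierstrassCurve Literature.NumberTheory.EllipticCurves
  Literature.NumberTheory.EllipticCurves.ModularForms
  Literature.NumberTheory.EllipticCurves.Rank1Residual Literature.NumberTheory.EllipticCurves.Rank1Residual.Typed
  Literature.NumberTheory.EllipticCurves.Kobayashi2003 Literature.NumberTheory.EllipticCurves.IwasawaDual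
  ZpExtension Summit.BirchSwinnertonDyer.Rank1Residual Summit.BirchSwinnertonDyer.Rank1Residual.Supersingular
  Summit.BirchSwinnertonDyer.Rank1Residual.X5 Summit.BirchSwinnertonDyer.Rank1Residual.X5.O1
  Summit.BirchSwinnertonDyer.Rank1Residual.X5.Instances
  Summit.BirchSwinnertonDyer.BirchSwinnertonDyer.Theses.ThetaPartnerAtTwo

namespace Summit.BirchSwinnertonDyer.BirchSwinnertonDyer.Theorems
namespace SSThetaRoad

/-- **`BSD(157113h1, 2)` ON THE UNIT-ZONE THETA ROAD — NO K2r0.** Displayed: PUB {`hPub` = modularity ∧ GZK, `hBF` =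
Burungale–Flach, `h2` = Abbes–Ullmo at `2`}, Kato PUB (1′) `hKatoPub`, 19097's stubs (2′) `hEC` and (4) `hCK` VERBATIM,
(2′)^CM `hECcm` (Kim's signed Euler characteristic at `2` for CM curves), TP2 K1 `hT` BY NAME, CERT {`L(E,1) ≠ 0`
(Cremona), the unit certificate `L(A,1)/Ω_A = t, t ≠ 0, ord₂ t = 0` for `A = 27a3` (`t = 1/9`, Cremona allbsd + kit
j280801)}. KERNEL: `E` non-CM, good ss at `2`, `a₂ = 0`, globally minimal; `A` CM, good ss at `2`, `a₂ = 0`, globally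
minimal; `E[2] ≅ A[2]`. Closes nothing by itself. [cite: GreenbergVatsal2000, Thm. (1.4)] [cite: Kobayashi2003, Thm. 1.2 and Thm. 4.1]
[cite: BDKim2013, Cor. 3.15] [cite: BurungaleFlach2024, Thm. 1.1] [cite: AbbesUllmo1996, Thm. A]
[cite: CremonaAlgorithms1997, Table 1] [cite: Miller2011LMS, Def. 1.1] -/
theorem bsdp_two_157113h1_of_unitZonePartner_of_stubs
    (hPub : nonempty_modularParametrizationData ∧ rank_eq_analyticRank_of_analyticRank_le_one)
    (hBF : bsdTriple_of_hasCM_of_L_one_ne_zero)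
    (h2 : Literature.NumberTheory.EllipticCurves.realPeriodRat_eq_unit_mul_plusPeriod_two)
    (hKatoPub : Kato2004.thm12_4 ∧ Kato2004_fineSelmerDual_isTorsion)
    (hEC : ∀ (W : WeierstrassCurve ℚ) [W.IsElliptic] [W.IsGloballyMinimal],
        ¬ W.HasCM → W.analyticRank = 0 → GoodSS W 2 → W.frobeniusTrace 2 = 0 →
        ∀ (κ : ZpExtension ℚ 2) (γ : Field.absoluteGaloisGroup ℚ),
          κ.IsCyclotomic → κ.IsTopGenerator γ → Finite (W.selmerGroupPInfty 2) →
          Finite (endInvariants (conjSignedSelmerInfty W κ 1 γ - 1)) ∧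
            ∃ u : ℤ_[2]ˣ, (Nat.card (endInvariants (conjSignedSelmerInfty W κ 1 γ - 1)) : ℚ_[2]) =
              ((u : ℤ_[2]) : ℚ_[2]) * ((2 : ℕ) : ℚ_[2]) ^ (padicValNat 2 W.tamagawaProduct) *
                (Nat.card (W.selmerGroupPInfty 2) : ℚ_[2]) *
                  (Nat.card (EndCoinvariants (conjSignedSelmerInfty W κ 1 γ - 1)) : ℚ_[2]))
    (hCK : ∀ (W : WeierstrassCurve ℚ) [W.IsElliptic] [W.IsGloballyMinimal],
      ¬ W.HasCM → W.analyticRank = 0 → GoodSS W 2 → W.frobeniusTrace 2 = 0 →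
      ∀ (κ : ZpExtension ℚ 2) (γ : Field.absoluteGaloisGroup ℚ),
        κ.IsCyclotomic → κ.IsTopGenerator γ → IsCyclotomicVariable 2 γ →
        ∀ [NeZero (W.conductorNorm ℤ)] (f : CuspForm (Gamma0 (W.conductorNorm ℤ)) 2),
          IsNewformOf W f → ∀ (ϖ : ℚ), (ϖ : ℝ) * W.realPeriodRat = plusPeriod f →
        ∀ (Lplus Lminus : IwasawaAlgebra 2), IsPollackPair f 2 Lplus Lminus →
        ∀ (D : SignedSelmerDualData W κ γ 1) [ContinuousSMul ℤ_[2] (W.tateModule 2)],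
          ∃ (I : Kato2004.IwasawaH1Data W 2 κ γ) (Y : W.FineSelmerDualData κ γ)
            (P : Submodule (IwasawaAlgebra 2) (IwasawaAlgebra 2))
            (loc : I.H →ₗ[IwasawaAlgebra 2] P) (toX : P →ₗ[IwasawaAlgebra 2] D.X)
            (δ : D.X →ₗ[IwasawaAlgebra 2] Y.X) (Z : Submodule (IwasawaAlgebra 2) I.H)
            (G : IwasawaAlgebra 2),
            Function.Exact loc toX ∧ Function.Exact toX δ ∧
            G ∈ Submodule.map (P.subtype ∘ₗ loc) Z ∧
            iwasawaToPowerSeries 2 G =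
              PowerSeries.C (ϖ : ℚ_[2]) * iwasawaToPowerSeries 2 (kobayashiL 1 Lplus Lminus) ∧
            (∀ 𝔭 : PrimeSpectrum (IwasawaAlgebra 2), 𝔭.asIdeal.height = 1 →
              PowerSeries.C (2 : ℤ_[2]) ∉ 𝔭.asIdeal →
              Literature.NumberTheory.EllipticCurves.Module.lengthAt (IwasawaAlgebra 2) Y.X 𝔭 ≤
                Literature.NumberTheory.EllipticCurves.Module.lengthAt (IwasawaAlgebra 2) (I.H ⧸ Z) 𝔭) ∧
            (TwoAdicSurjective W →
              ∀ 𝔭 : PrimeSpectrum (IwasawaAlgebra 2), 𝔭.asIdeal.height = 1 →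
                PowerSeries.C (2 : ℤ_[2]) ∈ 𝔭.asIdeal →
                Literature.NumberTheory.EllipticCurves.Module.lengthAt (IwasawaAlgebra 2) Y.X 𝔭 ≤
                  Literature.NumberTheory.EllipticCurves.Module.lengthAt (IwasawaAlgebra 2) (I.H ⧸ Z) 𝔭))
    (hECcm : ∀ (A : WeierstrassCurve ℚ) [A.IsElliptic] [A.IsGloballyMinimal],
        A.HasCM → A.analyticRank = 0 → GoodSS A 2 → A.frobeniusTrace 2 = 0 →
        ∀ (κ : ZpExtension ℚ 2) (γ : Field.absoluteGaloisGroup ℚ),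
          κ.IsCyclotomic → κ.IsTopGenerator γ → Finite (A.selmerGroupPInfty 2) →
          Finite (endInvariants (conjSignedSelmerInfty A κ 1 γ - 1)) ∧
            ∃ u : ℤ_[2]ˣ, (Nat.card (endInvariants (conjSignedSelmerInfty A κ 1 γ - 1)) : ℚ_[2]) =
              ((u : ℤ_[2]) : ℚ_[2]) * ((2 : ℕ) : ℚ_[2]) ^ (padicValNat 2 A.tamagawaProduct) *
                (Nat.card (A.selmerGroupPInfty 2) : ℚ_[2]) *
                  (Nat.card (EndCoinvariants (conjSignedSelmerInfty A κ 1 γ - 1)) : ℚ_[2]))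
    (hT : SignedTransportAtTwo)
    (hunit : ∃ t : ℚ, ((⟨0, 0, 1, 0, 0⟩ : WeierstrassCurve ℤ).baseChange ℚ).entireLFunction 1 /
        ((((⟨0, 0, 1, 0, 0⟩ : WeierstrassCurve ℤ).baseChange ℚ).realPeriodRat : ℝ) : ℂ) = (t : ℂ) ∧
        t ≠ 0 ∧ padicValRat 2 t = 0) :
    ∀ (W : WeierstrassCurve ℚ) [W.IsElliptic] [W.IsGloballyMinimal],
      W = (⟨0, 0, 1, -2285565660, -42057036462382⟩ : WeierstrassCurve ℤ).baseChange ℚ → W.entireLFunction 1 ≠ 0 → BSDp W 2 := by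
  intro W _ _ hW hL
  subst hW
  haveI := isElliptic_cmA27a
  haveI := isGloballyMinimal_cmA27a
  obtain ⟨e, he⟩ := twoTorsion_congruent_157113h1
  exact ThetaPartnerXRoute.bsdp_two_of_unitZonePartner_of_signedTransport_of_stubs hPub hBF h2 hKatoPub hEC hCK hECcm hT
    _ SSColemanRoad.not_hasCM_157113h1 (analyticRank_eq_zero_of_entireLFunction_one_ne_zero _ hL)
    SSColemanRoad.goodSS_two_157113h1.2.2 SSColemanRoad.goodSS_two_157113h1.2.1
    _ hasCM_cmA27a goodSS_two_cmA27a.2.2 goodSS_two_cmA27a.2.1 hunit e he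

/-- **The unit-zone theta-habitat WITNESS for `157113h1`** — the habitat clause of
`ThetaPartnerXRoute.thetaHabitatUnitZone_of_signedTransport_of_stubs` AT this curve: a CM partner (`cmA27a` = 27a3) good
supersingular at `2` with `a₂ = 0`, the unit certificate (`hunit`, the only non-kernel input), and a Galois-equivariant
`E[2] ≃ A[2]` (kernel). [cite: SilvermanAEC2009, III.§1, Cor. III.6.4(b), VII.5 Prop. 5.1 and App. C §11] -/
theorem thetaHabitatUnitZoneWitness_157113h1
    (hunit : ∃ t : ℚ, ((⟨0, 0, 1, 0, 0⟩ : WeierstrassCurve ℤ).baseChange ℚ).entireLFunction 1 /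
        ((((⟨0, 0, 1, 0, 0⟩ : WeierstrassCurve ℤ).baseChange ℚ).realPeriodRat : ℝ) : ℂ) = (t : ℂ) ∧
        t ≠ 0 ∧ padicValRat 2 t = 0) :
    ∃ (A : WeierstrassCurve ℚ) (_ : A.IsElliptic) (_ : A.IsGloballyMinimal),
      A.HasCM ∧ GoodSS A 2 ∧ A.frobeniusTrace 2 = 0 ∧
        (∃ t : ℚ, A.entireLFunction 1 / (A.realPeriodRat : ℂ) = (t : ℂ) ∧ t ≠ 0 ∧ padicValRat 2 t = 0) ∧
        ∃ e : geomTorsion ((⟨0, 0, 1, -2285565660, -42057036462382⟩ : WeierstrassCurve ℤ).baseChange ℚ) (2 : ℤ) ≃+ geomTorsion A (2 : ℤ),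
          ∀ (σ : Field.absoluteGaloisGroup ℚ) (P : geomTorsion ((⟨0, 0, 1, -2285565660, -42057036462382⟩ : WeierstrassCurve ℤ).baseChange ℚ) (2 : ℤ)),
            e (σ • P) = σ • e P := by
  haveI := isElliptic_cmA27a
  haveI := isGloballyMinimal_cmA27a
  obtain ⟨e, he⟩ := twoTorsion_congruent_157113h1
  exact ⟨_, isElliptic_cmA27a, isGloballyMinimal_cmA27a, hasCM_cmA27a, goodSS_two_cmA27a.2.2, goodSS_two_cmA27a.2.1,
    hunit, e, he⟩

end SSThetaRoad
end Summit.BirchSwinnertonDyer.BirchSwinnertonDyer.Theorems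

end
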